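import Literature.Geometry.Lorentzian.BogovskiiDoubleDivergence
import Mathlib.Analysis.Calculus.ParametricIntegral
import HarnessLib

/-!
# Differentiating the Bogovskiĭ weight in the base point

(trunk G08 = T-LORENTZ; family `gr`; namespace `Literature.Geometry.Lorentzian.MaoOhTao`.)

Mao–Oh–Tao (arXiv:2308.13031), Lemma 2.3: the kernel of `S` is `Ψ^{ij}_η(z + y, y) = w_y(|z|, z/|z|) zⁱzʲ/|z|³` with the
weight `w_y(r, α) = ∫_r^∞ η(sα + y) s² ds` (`bogovskiiWeight η y r α`).  Regularity of `S f` in `x` (writing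
`(S f)(x) = ∫ w_{x−z}(|z|, z/|z|) zⁱzʲ/|z|³ f(x − z) dz`) rests on the differentiability of the weight in the base point
`y`, which is differentiation under the integral sign: for `η ∈ C¹_c`,

  `D_y w_y(r, α) = ∫_r^∞ s² Dη(sα + y) ds`,  in particular `∂_{y_m} w_y(r, α) = w^{(∂_mη)}_y(r, α)`

— the same weight with `η` replaced by `∂_mη` (`hasFDerivAt_bogovskiiWeight_base`, `fderiv_bogovskiiWeight_base_apply_e`),
so that every bound and continuity statement for the weight (`BogovskiiDoubleDivergence.lean`, `BogovskiiOperator.lean`)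
applies to its `y`-derivatives.  Consequences recorded here: `contDiff_one_bogovskiiWeight_base` … (the weight is `C¹`
in `y` for fixed `(r, α)`, `|α| = 1`).

Everything is proved; no definitions, no named facts.

## References

* Y. Mao, S.-J. Oh, T. Tao, arXiv:2308.13031 (2023), Lemma 2.3, p. 8 (key `MaoOhTao2023`).
-/

noncomputable section

open scoped RealInnerProductSpace Topology
open Filter MeasureTheory Set Metric Function

namespace Literature.Geometry.Lorentzian

namespace MaoOhTao

variable {η : E3 → ℝ} {R : ℝ}

/-- Off the support, the derivative vanishes too: `Dη(sα + y) = 0` for `|s| > R + |y|`. [folklore] -/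
theorem fderiv_eta_line_eq_zero (hR : ∀ z : E3, R < ‖z‖ → η z = 0) {α : E3} (hα : ‖α‖ = 1) {y : E3} {s : ℝ}
    (hs : R + ‖y‖ < |s|) : fderiv ℝ η (s • α + y) = 0 := by
  -- `η` vanishes on the open set `{R < |z|}`, a neighbourhood of `sα + y`
  have hmem : R < ‖s • α + y‖ := by
    have h1 : ‖s • α‖ = |s| := by rw [norm_smul, hα, mul_one, Real.norm_eq_abs]
    have h2 : ‖s • α‖ ≤ ‖s • α + y‖ + ‖y‖ := by
      calc ‖s • α‖ = ‖(s • α + y) - y‖ := by rw [add_sub_cancel_right]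
        _ ≤ ‖s • α + y‖ + ‖y‖ := norm_sub_le _ _
    linarith
  have hev : η =ᶠ[𝓝 (s • α + y)] fun _ ↦ 0 := by
    have ho : IsOpen {z : E3 | R < ‖z‖} := isOpen_lt continuous_const continuous_norm
    filter_upwards [ho.mem_nhds hmem] with z hz
    exact hR z hz
  rw [hev.fderiv_eq]
  exact fderiv_const_apply 0

/-- **The weight is differentiable in the base point, with derivative under the integral sign**:
`D_y w_y(r, α) = ∫_r^∞ s² Dη(sα + y) ds` for `η ∈ C¹` vanishing off `B̄_R` and `|α| = 1`.
[cite: MaoOhTao2023, Lemma 2.3] -/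
theorem hasFDerivAt_bogovskiiWeight_base (hη : ContDiff ℝ 1 η) (hR : ∀ z : E3, R < ‖z‖ → η z = 0) {α : E3}
    (hα : ‖α‖ = 1) (r : ℝ) (y₀ : E3) :
    HasFDerivAt (fun y ↦ bogovskiiWeight η y r α)
      (∫ s in Ioi r, (s ^ 2) • fderiv ℝ η (s • α + y₀)) y₀ := by
  have hηc : Continuous η := hη.continuous
  have hdc : Continuous (fderiv ℝ η) := hη.continuous_fderiv one_ne_zero
  obtain ⟨M, hM⟩ := hdc.bounded_above_of_compact_support ((HasCompactSupport.intro (isCompact_closedBall (0 : E3) R)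
    fun z hz ↦ hR z (by rwa [mem_closedBall, dist_zero_right, not_le] at hz)).fderiv (𝕜 := ℝ))
  have hM0 : 0 ≤ M := (norm_nonneg _).trans (hM 0)
  set T : ℝ := |R + ‖y₀‖ + 1| + 1 with hT
  have hT0 : 0 < T := by positivity
  set F : E3 → ℝ → ℝ := fun y s ↦ η (s • α + y) * s ^ 2 with hF
  set F' : E3 → ℝ → (E3 →L[ℝ] ℝ) := fun y s ↦ (s ^ 2) • fderiv ℝ η (s • α + y) with hF'
  have hF_meas : ∀ᶠ y in 𝓝 y₀, AEStronglyMeasurable (F y) (volume.restrict (Ioi r)) :=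
    Eventually.of_forall fun y ↦ (continuous_eta_line hηc α y).aestronglyMeasurable
  have hF_int : Integrable (F y₀) (volume.restrict (Ioi r)) := (integrable_eta_line hηc hR hα y₀).restrict
  have hF'c : ∀ y, Continuous (F' y) := fun y ↦
    (continuous_pow 2).smul (hdc.comp ((continuous_id.smul continuous_const).add continuous_const))
  have hF'_meas : AEStronglyMeasurable (F' y₀) (volume.restrict (Ioi r)) := (hF'c y₀).aestronglyMeasurable
  -- the bound `M T² 𝟙_{[-T, T]}`
  have h_bound : ∀ᵐ s ∂(volume.restrict (Ioi r)), ∀ y ∈ ball y₀ 1, ‖F' y s‖ ≤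
      (Icc (-T) T).indicator (fun _ ↦ M * T ^ 2) s := by
    refine ae_of_all _ fun s y hy ↦ ?_
    rw [mem_ball, dist_eq_norm] at hy
    by_cases hs : s ∈ Icc (-T) T
    · rw [indicator_of_mem hs, hF', norm_smul, Real.norm_eq_abs, abs_pow, mul_comm]
      have h1 : ‖fderiv ℝ η (s • α + y)‖ ≤ M := hM _
      have h2 : |s| ≤ T := abs_le.2 ⟨hs.1, hs.2⟩
      exact mul_le_mul h1 (pow_le_pow_left₀ (abs_nonneg s) h2 2) (by positivity) hM0
    · rw [indicator_of_notMem hs]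
      have hTs : T < |s| := by
        by_contra h
        exact hs (abs_le.1 (not_lt.1 h))
      have hy' : ‖y‖ ≤ ‖y₀‖ + 1 := by
        have := norm_le_norm_sub_add y y₀
        rw [← norm_neg, neg_sub] at hy
        linarith [norm_sub_rev y y₀]
      have hs' : R + ‖y‖ < |s| := by linarith [le_abs_self (R + ‖y₀‖ + 1)]
      rw [hF']
      simp only
      rw [fderiv_eta_line_eq_zero hR hα hs', smul_zero, norm_zero]
  have hbi : Integrable (fun s : ℝ ↦ (Icc (-T) T).indicator (fun _ ↦ M * T ^ 2) s) (volume.restrict (Ioi r)) :=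
    ((integrable_indicator_iff measurableSet_Icc).2 (continuous_const.integrableOn_Icc)).restrict
  have h_diff : ∀ᵐ s ∂(volume.restrict (Ioi r)), ∀ y ∈ ball y₀ 1, HasFDerivAt (F · s) (F' y s) y := by
    refine ae_of_all _ fun s y _ ↦ ?_
    have h1 : HasFDerivAt (fun y : E3 ↦ s • α + y) (ContinuousLinearMap.id ℝ E3) y :=
      (hasFDerivAt_id y).const_add (s • α)
    have h2 : HasFDerivAt η (fderiv ℝ η (s • α + y)) (s • α + y) :=
      (hη.differentiable one_ne_zero _).hasFDerivAt
    have h3 := h2.comp y h1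
    rw [ContinuousLinearMap.comp_id] at h3
    have h4 : HasFDerivAt (fun y : E3 ↦ η (s • α + y) * s ^ 2) ((s ^ 2) • fderiv ℝ η (s • α + y)) y := by
      have := h3.mul_const (s ^ 2)
      simpa only [Function.comp_def] using this
    exact h4
  exact hasFDerivAt_integral_of_dominated_of_fderiv_le (ball_mem_nhds y₀ one_pos) hF_meas hF_int hF'_meas h_bound
    hbi h_diff

/-- The derivative integrand is integrable. [folklore] -/
theorem integrable_fderiv_eta_line (hη : ContDiff ℝ 1 η) (hR : ∀ z : E3, R < ‖z‖ → η z = 0) {α : E3} (hα : ‖α‖ = 1)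
    (y : E3) : Integrable fun s : ℝ ↦ (s ^ 2) • fderiv ℝ η (s • α + y) := by
  have hdc : Continuous (fderiv ℝ η) := hη.continuous_fderiv one_ne_zero
  have hc : Continuous fun s : ℝ ↦ (s ^ 2) • fderiv ℝ η (s • α + y) :=
    (continuous_pow 2).smul (hdc.comp ((continuous_id.smul continuous_const).add continuous_const))
  refine hc.integrable_of_hasCompactSupport ?_
  refine HasCompactSupport.intro (isCompact_closedBall (0 : ℝ) (R + ‖y‖)) fun s hs ↦ ?_
  rw [mem_closedBall, dist_zero_right, Real.norm_eq_abs, not_le] at hs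
  rw [fderiv_eta_line_eq_zero hR hα hs, smul_zero]

/-- **`∂_{y_m} w_y(r, α) = w^{(∂_mη)}_y(r, α)`**: the partial derivatives of the weight in the base point are the weights of
the partial derivatives of `η`. [cite: MaoOhTao2023, Lemma 2.3] -/
theorem fderiv_bogovskiiWeight_base_apply (hη : ContDiff ℝ 1 η) (hR : ∀ z : E3, R < ‖z‖ → η z = 0) {α : E3}
    (hα : ‖α‖ = 1) (r : ℝ) (y : E3) (m : Fin 3) :
    fderiv ℝ (fun y' ↦ bogovskiiWeight η y' r α) y (e m) = bogovskiiWeight (pd m η) y r α := by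
  rw [(hasFDerivAt_bogovskiiWeight_base hη hR hα r y).fderiv,
    ContinuousLinearMap.integral_apply (integrable_fderiv_eta_line hη hR hα y).restrict (e m)]
  simp only [bogovskiiWeight, pd, FunLike.coe_smul, Pi.smul_apply, smul_eq_mul]
  exact integral_congr_ae (ae_of_all _ fun s ↦ mul_comm _ _)

/-- The weight is differentiable in the base point. [folklore] -/
theorem differentiable_bogovskiiWeight_base (hη : ContDiff ℝ 1 η) (hR : ∀ z : E3, R < ‖z‖ → η z = 0) {α : E3}
    (hα : ‖α‖ = 1) (r : ℝ) : Differentiable ℝ fun y ↦ bogovskiiWeight η y r α :=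
  fun y ↦ (hasFDerivAt_bogovskiiWeight_base hη hR hα r y).differentiableAt

/-- `∂_mη` vanishes off `B̄_R` when `η` does. [folklore] -/
theorem pd_eq_zero_of_norm_lt (hR : ∀ z : E3, R < ‖z‖ → η z = 0) (m : Fin 3) (z : E3) (hz : R < ‖z‖) :
    pd m η z = 0 := by
  have hev : η =ᶠ[𝓝 z] fun _ ↦ 0 := by
    have ho : IsOpen {z : E3 | R < ‖z‖} := isOpen_lt continuous_const continuous_norm
    filter_upwards [ho.mem_nhds hz] with w hw
    exact hR w hw
  simp only [pd, hev.fderiv_eq, fderiv_const_apply]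
  rfl

/-! ### Uniform bounds and joint continuity of the derivative weight -/

/-- Shifted form on a fixed domain: `∫_{(r,∞)} s² Dη(sα + y) ds = ∫_{(0,∞)} (u + r)² Dη((u + r)α + y) du`. [folklore] -/
theorem fderivWeight_eq_integral_Ioi_zero (η : E3 → ℝ) (y : E3) (r : ℝ) (α : E3) :
    ∫ s in Ioi r, (s ^ 2) • fderiv ℝ η (s • α + y) =
      ∫ u in Ioi (0 : ℝ), ((u + r) ^ 2) • fderiv ℝ η ((u + r) • α + y) := by
  rw [← integral_indicator measurableSet_Ioi, ← integral_indicator measurableSet_Ioi,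
    ← integral_add_right_eq_self _ r]
  congr 1
  funext u
  simp only [indicator]
  have : (u + r ∈ Ioi r) ↔ (u ∈ Ioi (0 : ℝ)) := by simp
  by_cases hu : u ∈ Ioi (0 : ℝ)
  · rw [if_pos (this.2 hu), if_pos hu]
  · rw [if_neg (fun h ↦ hu (this.1 h)), if_neg hu]

/-- A bound `‖∫_r^∞ s² Dη(sα + y) ds‖ ≤ W'` uniform over `|y| ≤ Y`, all radii and all unit vectors. [folklore] -/
theorem exists_norm_fderivWeight_le_of_norm_le (hη : ContDiff ℝ 1 η) (hR : ∀ z : E3, R < ‖z‖ → η z = 0)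
    (Y : ℝ) : ∃ W, ∀ (y : E3), ‖y‖ ≤ Y → ∀ (r : ℝ) (α : E3), ‖α‖ = 1 →
      ‖∫ s in Ioi r, (s ^ 2) • fderiv ℝ η (s • α + y)‖ ≤ W := by
  have hdc : Continuous (fderiv ℝ η) := hη.continuous_fderiv one_ne_zero
  obtain ⟨M, hM⟩ := hdc.bounded_above_of_compact_support ((HasCompactSupport.intro (isCompact_closedBall (0 : E3) R)
    fun z hz ↦ hR z (by rwa [mem_closedBall, dist_zero_right, not_le] at hz)).fderiv (𝕜 := ℝ))
  have hM0 : 0 ≤ M := (norm_nonneg _).trans (hM 0)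
  set T : ℝ := |R + Y| + 1 with hT
  have hT0 : 0 < T := by positivity
  refine ⟨2 * T * (M * T ^ 2), fun y hy r α hα ↦ ?_⟩
  set q : ℝ → (E3 →L[ℝ] ℝ) := fun s ↦ (s ^ 2) • fderiv ℝ η (s • α + y) with hq
  have hqi : Integrable q := integrable_fderiv_eta_line hη hR hα y
  have hbound : ∀ s, ‖q s‖ ≤ (Icc (-T) T).indicator (fun _ ↦ M * T ^ 2) s := by
    intro s
    by_cases hs : s ∈ Icc (-T) T
    · rw [indicator_of_mem hs, hq, norm_smul, Real.norm_eq_abs, abs_pow, mul_comm]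
      have h1 : ‖fderiv ℝ η (s • α + y)‖ ≤ M := hM _
      have h2 : |s| ≤ T := abs_le.2 ⟨hs.1, hs.2⟩
      exact mul_le_mul h1 (pow_le_pow_left₀ (abs_nonneg s) h2 2) (by positivity) hM0
    · rw [indicator_of_notMem hs]
      have hTs : T < |s| := by
        by_contra h
        exact hs (abs_le.1 (not_lt.1 h))
      have hs' : R + ‖y‖ < |s| := by linarith [le_abs_self (R + Y)]
      show ‖(s ^ 2) • fderiv ℝ η (s • α + y)‖ ≤ 0
      rw [fderiv_eta_line_eq_zero hR hα hs', smul_zero, norm_zero]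
  have hind : Integrable fun s : ℝ ↦ (Icc (-T) T).indicator (fun _ ↦ M * T ^ 2) s :=
    (integrable_indicator_iff measurableSet_Icc).2 (continuous_const.integrableOn_Icc)
  calc ‖∫ s in Ioi r, q s‖ ≤ ∫ s in Ioi r, ‖q s‖ := norm_integral_le_integral_norm _
    _ ≤ ∫ s, ‖q s‖ := setIntegral_le_integral hqi.norm (Eventually.of_forall fun s ↦ norm_nonneg _)
    _ ≤ ∫ s, (Icc (-T) T).indicator (fun _ ↦ M * T ^ 2) s := integral_mono hqi.norm hind hbound
    _ = 2 * T * (M * T ^ 2) := by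
        rw [integral_indicator measurableSet_Icc, setIntegral_const, Real.volume_real_Icc_of_le (by linarith),
          smul_eq_mul]
        ring

/-- **Joint continuity of the derivative weight**: `(y, r, α) ↦ ∫_r^∞ s² Dη(sα + y) ds` is continuous on
`univ × univ × 𝕊²`. [folklore] -/
theorem continuousOn_fderivWeight_param (hη : ContDiff ℝ 1 η) (hR : ∀ z : E3, R < ‖z‖ → η z = 0) :
    ContinuousOn (fun p : E3 × ℝ × E3 ↦ ∫ s in Ioi p.2.1, (s ^ 2) • fderiv ℝ η (s • p.2.2 + p.1))
      (univ ×ˢ (univ ×ˢ sphere (0 : E3) 1)) := by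
  have hdc : Continuous (fderiv ℝ η) := hη.continuous_fderiv one_ne_zero
  have hT : ∀ Y T : ℝ, ContinuousOn (fun p : E3 × ℝ × E3 ↦ ∫ s in Ioi p.2.1, (s ^ 2) • fderiv ℝ η (s • p.2.2 + p.1))
      (closedBall (0 : E3) Y ×ˢ (Icc (-T) T ×ˢ sphere (0 : E3) 1)) := by
    intro Y T
    have hf : ContinuousOn (uncurry fun (p : E3 × ℝ × E3) (u : ℝ) ↦
        ((u + p.2.1) ^ 2) • fderiv ℝ η ((u + p.2.1) • p.2.2 + p.1))
        ((closedBall (0 : E3) Y ×ˢ (Icc (-T) T ×ˢ sphere (0 : E3) 1)) ×ˢ univ) := by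
      refine Continuous.continuousOn ?_
      have hr : Continuous fun q : (E3 × ℝ × E3) × ℝ ↦ q.2 + q.1.2.1 :=
        continuous_snd.add (continuous_fst.comp (continuous_snd.comp continuous_fst))
      refine (hr.pow 2).smul (hdc.comp ?_)
      exact (hr.smul (continuous_snd.comp (continuous_snd.comp continuous_fst))).add
        (continuous_fst.comp continuous_fst)
    have hk : IsCompact (Icc (-(R + Y + T)) (R + Y + T)) := isCompact_Icc
    have h := continuousOn_integral_of_compact_support (μ := (volume : Measure ℝ).restrict (Ioi 0)) hk hf
      (fun p u hp hu ↦ ?_)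
    · refine h.congr fun p _ ↦ ?_
      exact fderivWeight_eq_integral_Ioi_zero η p.1 p.2.1 p.2.2
    · have hy : ‖p.1‖ ≤ Y := by simpa [mem_closedBall, dist_zero_right] using hp.1
      have hα : ‖p.2.2‖ = 1 := by simpa using hp.2.2
      have hr : |p.2.1| ≤ T := abs_le.2 ⟨hp.2.1.1, hp.2.1.2⟩
      have hu' : R + Y + T < |u| := by
        by_contra hcon
        exact hu (abs_le.1 (not_lt.1 hcon))
      have hs : R + ‖p.1‖ < |u + p.2.1| := by
        have h2 : |u| ≤ |u + p.2.1| + |p.2.1| := by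
          calc |u| = |(u + p.2.1) - p.2.1| := by rw [add_sub_cancel_right]
            _ ≤ |u + p.2.1| + |p.2.1| := abs_sub _ _
        linarith
      show ((u + p.2.1) ^ 2) • fderiv ℝ η ((u + p.2.1) • p.2.2 + p.1) = 0
      rw [fderiv_eta_line_eq_zero hR hα hs, smul_zero]
  intro p hp
  set Y : ℝ := ‖p.1‖ + 1 with hYdef
  set T : ℝ := |p.2.1| + 1 with hTdef
  have hmem : p ∈ closedBall (0 : E3) Y ×ˢ (Icc (-T) T ×ˢ sphere (0 : E3) 1) :=
    ⟨by rw [mem_closedBall, dist_zero_right]; linarith,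
      ⟨by linarith [neg_abs_le p.2.1], by linarith [le_abs_self p.2.1]⟩, hp.2.2⟩
  refine ((hT Y T).continuousWithinAt hmem).mono_of_mem_nhdsWithin ?_
  refine mem_nhdsWithin.2 ⟨ball p.1 1 ×ˢ (Ioo (-T) T ×ˢ univ),
    isOpen_ball.prod (isOpen_Ioo.prod isOpen_univ),
    ⟨mem_ball_self one_pos, ⟨by linarith [neg_abs_le p.2.1], by linarith [le_abs_self p.2.1]⟩, mem_univ _⟩, ?_⟩
  rintro q ⟨⟨hq1, hq2, -⟩, ⟨-, -, hq3⟩⟩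
  refine ⟨?_, ⟨hq2.1.le, hq2.2.le⟩, hq3⟩
  rw [mem_closedBall, dist_zero_right]
  rw [mem_ball, dist_eq_norm] at hq1
  have := norm_le_insert' q.1 p.1
  linarith

/-- The derivative weight is continuous off the diagonal: `(x, y) ↦ D_y w_y(|x − y|, (x − y)/|x − y|)` on `{x ≠ y}`.
[folklore] -/
theorem continuousOn_fderivWeight_sub (hη : ContDiff ℝ 1 η) (hR : ∀ z : E3, R < ‖z‖ → η z = 0) :
    ContinuousOn (fun p : E3 × E3 ↦ ∫ s in Ioi ‖p.1 - p.2‖, (s ^ 2) • fderiv ℝ η (s • (‖p.1 - p.2‖⁻¹ • (p.1 - p.2)) + p.2))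
      {p | p.1 ≠ p.2} := by
  have hsub : Continuous fun p : E3 × E3 ↦ p.1 - p.2 := continuous_fst.sub continuous_snd
  refine (continuousOn_fderivWeight_param hη hR).comp
    (continuous_snd.continuousOn.prodMk ((continuous_norm.comp hsub).continuousOn.prodMk
      (((continuousOn_inv₀.comp (continuous_norm.comp hsub).continuousOn fun p hp ↦ ?_)).smul
        hsub.continuousOn))) fun p hp ↦ ⟨mem_univ _, mem_univ _, ?_⟩
  · simpa [sub_eq_zero] using hp
  · have hz : p.1 - p.2 ≠ 0 := sub_ne_zero.2 hp
    show ‖p.1 - p.2‖⁻¹ • (p.1 - p.2) ∈ sphere (0 : E3) 1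
    rw [mem_sphere_zero_iff_norm, norm_smul, norm_inv, norm_norm, inv_mul_cancel₀ (norm_ne_zero_iff.2 hz)]

end MaoOhTao

end Literature.Geometry.Lorentzian

end
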